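import Summits.AtomisticToContinuum.Crystallization.Theorems.StrictCertificate.Negative.StrictCertificateFalseOfHcpFarFieldEmpty
import Summits.AtomisticToContinuum.Crystallization.Theorems.BraggSlacknessRigidityStrictCertificateFourierMoment
import HarnessLib

/-!
# `StrictCertificate` (stmt-AtomisticToContinuum-13167) — negative lemma, II:
# the crux is refuted by EMPTINESS OF THE **FLAT** hcp FAR FIELD (`HcpFlatFarFieldEmpty`)

Lead c4.  The previous negative lemma (`…FalseOfHcpFarFieldEmpty`, lead c3) hands the standing disprover the
eighteen far-field clauses every witness kernel `f` of the crux satisfies at its template `hcp(a,h)`.  This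
file WEAKENS the hypothesis it must prove by adding to the negated conjunction the four REGULARITY clauses
landed this seat (so a non-interpolation argument may assume them):

(19) FLATNESS at the origin — `0 < δ` and `0 ≤ f 0 − f r ≤ K r²` for `0 ≤ r ≤ δ`
     (`…Flatness.f_zero_sub_f_le_mul_sq`: Einstein domination at a displaced site, single-site stability of
     the finite-range cone, second-order Taylor bound for `Ṽ(s) = s⁻⁶/12 − s⁻³/6`);
(20) FINITE SECOND FOURIER MOMENT — `ξ ↦ ‖ξ‖² Re 𝓕F(ξ)` integrable with `∫ ‖ξ‖² Re 𝓕F ≤ 3K/(2π²)`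
     (`…FourierMoment`: Fourier inversion + Fatou);
(21) `F = f∘‖·‖ ∈ C²(ℝ³)` (`Real.contDiff_fourier`);
(22) the `g`-FREE EINSTEIN BOUND at every site and probe — `f 0 − f(dist w p₀) ≤ ΔE_V(p₀ ↦ w)`, the
     Lennard-Jones cavity excess of the template (`…EinsteinCavity.f_zero_sub_f_le_lennardJones_cavity`).

  `strictCertificate_false_of_hcpFlatFarFieldEmpty : HcpFlatFarFieldEmpty → ¬ StrictCertificate`,
  `hcpFlatFarFieldEmpty_of_hcpFarFieldEmpty : HcpFarFieldEmpty → HcpFlatFarFieldEmpty` (the new `H` is weaker).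

As before this is a negative lemma modulo `H`, not a refutation: `H` is expected TRUE (one-sided radial
Fourier interpolation at hcp is supercritical in `d = 3`) but no catalogued theorem proves it.  No cited
facts; the only new declaration is `H`.
-/

-- justification: the file lives in `Theorems/StrictCertificate/Negative/` and declares into the matching
-- namespace `…Theorems.StrictCertificate.Negative` (same layout as the sibling negative lemma, p149331).
set_option linter.dupNamespace false

noncomputable section

namespace Summit.AtomisticToContinuum.Crystallization.Theorems.StrictCertificate.Negative

open Literature.MathematicalPhysics.StatisticalMechanics
open Summit.AtomisticToContinuum.Crystallization.Theses.BraggSlacknessRigidity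
open Summit.AtomisticToContinuum.Crystallization.Theorems.ExactCertificateNegative (IsSplit)
open Summit.AtomisticToContinuum.Crystallization.Theorems.ChargedEnergyGapNegative (E3 eStar eStar_le)
open Summit.AtomisticToContinuum.Crystallization.Theorems.ThreeConeCertificateExactCertificate.Slackness
  (witness_eq f_zero_add_two_mul_energyPerParticle_f)
open Summit.AtomisticToContinuum.Crystallization.Theorems.ThreeConeCertificateExactCertificate.Field
  (invisible_of_isSplit)
open Summit.AtomisticToContinuum.Crystallization.Theorems.ThreeConeCertificateExactCertificate.Contact
  (stub_tangency le_energyPerParticle_dilate)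
open Summit.AtomisticToContinuum.Crystallization.Theorems.ThreeConeCertificateExactCertificate.Dilation
  (stub_zeroPressure)
open Summit.AtomisticToContinuum.Crystallization.Theorems.BraggSlacknessRigidityStrictCertificate
  (fourier_zero_eq_zero f_eq_lennardJones_iff structureFactor_mul_fourier_eq_zero integral_fourier_eq_f_zero
    integrable_norm_sq_mul_fourier_of_isSplit f_zero_sub_f_le_lennardJones_cavity)
open MeasureTheory
open scoped BigOperators FourierTransform RealInnerProductSpace

/-- **Hypothesis `HcpFlatFarFieldEmpty`** (the `H` of the negative lemma below): for NO `a, h ≠ 0`, range `ρ`,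
radial kernel `f` and constants `K, δ` do the eighteen far-field clauses of `HcpFarFieldEmpty` hold at
`P := hcp(a,h)` TOGETHER WITH (19) flatness `0 ≤ f 0 − f r ≤ K r²` on `[0, δ]`, `δ > 0`; (20) integrability of
`‖ξ‖² Re 𝓕F` with `∫ ‖ξ‖² Re 𝓕F ≤ 3K/(2π²)`; (21) `F ∈ C²(ℝ³)`; (22) the Einstein bound
`f 0 − f(dist w p₀) ≤ Σ'_{y ≠ p₀} [V(dist w y) − V(dist p₀ y)]` for all sites `p₀ ∈ P` and probes `w ∉ P`.
Weaker than `HcpFarFieldEmpty` (`hcpFlatFarFieldEmpty_of_hcpFarFieldEmpty`), still sufficient to refute the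
crux. [folklore] -/
@[conjecture] def HcpFlatFarFieldEmpty : Prop :=
  ∀ (a h : ℝ) (ha : a ≠ 0) (hh : h ≠ 0) (ρ : ℝ) (f : ℝ → ℝ) (K δ : ℝ), ¬ (((∀ Q : Literature.MathematicalPhysics.StatisticalMechanics.PeriodicConfiguration 3, (Literature.MathematicalPhysics.StatisticalMechanics.hcpPeriodicConfiguration ha hh).energyPerParticle Literature.MathematicalPhysics.StatisticalMechanics.lennardJones ≤ Q.energyPerParticle Literature.MathematicalPhysics.StatisticalMechanics.lennardJones) ∧ ((Literature.MathematicalPhysics.StatisticalMechanics.hcpPeriodicConfiguration ha hh).energyPerParticle (fun r => (r⁻¹) ^ 6) = (Literature.MathematicalPhysics.StatisticalMechanics.hcpPeriodicConfiguration ha hh).energyPerParticle (fun r => (r⁻¹) ^ 12) ∧ (Literature.MathematicalPhysics.StatisticalMechanics.hcpPeriodicConfiguration ha hh).energyPerParticle Literature.MathematicalPhysics.StatisticalMechanics.lennardJones = -(1 / 12) * (Literature.MathematicalPhysics.StatisticalMechanics.hcpPeriodicConfiguration ha hh).energyPerParticle (fun r => (r⁻¹) ^ 6)) ∧ 0 <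 ρ ∧ Continuous (fun v : EuclideanSpace ℝ (Fin 3) => (f ‖v‖ : ℂ)) ∧ MeasureTheory.Integrable (fun v : EuclideanSpace ℝ (Fin 3) => (f ‖v‖ : ℂ)) ∧ MeasureTheory.Integrable (FourierTransform.fourier (fun v : EuclideanSpace ℝ (Fin 3) => (f ‖v‖ : ℂ))) ∧ (∀ ξ : EuclideanSpace ℝ (Fin 3), (FourierTransform.fourier (fun v : EuclideanSpace ℝ (Fin 3) => (f ‖v‖ : ℂ)) ξ).im = 0 ∧ 0 ≤ (FourierTransform.fourier (fun v : EuclideanSpace ℝ (Fin 3) => (f ‖v‖ : ℂ)) ξ).re) ∧ (∀ ξ : EuclideanSpace ℝ (Fin 3), ξ ≠ 0 → (∀ k : EuclideanSpace ℝ (Fin 3), (∀ g ∈ (Literature.MathematicalPhysics.StatisticalMechanics.hcpPeriodicConfiguration ha hh).lattice, ∃ n : ℤ, inner ℝ k g = (n : ℝ)) → ‖ξ‖ ≠ ‖k‖) → FourierTransform.fourier (fun v : EuclideanSpace ℝ (Fin 3) => (f ‖v‖ : ℂ)) ξ ≠ 0) ∧ FourierTransform.fourier (fun v : EuclideanSpace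 ℝ (Fin 3) => (f ‖v‖ : ℂ)) 0 = 0 ∧ (∀ k : EuclideanSpace ℝ (Fin 3), (∀ g ∈ (Literature.MathematicalPhysics.StatisticalMechanics.hcpPeriodicConfiguration ha hh).lattice, ∃ n : ℤ, inner ℝ k g = (n : ℝ)) → (∑ x ∈ (Literature.MathematicalPhysics.StatisticalMechanics.hcpPeriodicConfiguration ha hh).motif, Complex.exp (↑(-2 * Real.pi * inner ℝ x k) * Complex.I)) * FourierTransform.fourier (fun v : EuclideanSpace ℝ (Fin 3) => (f ‖v‖ : ℂ)) k = 0) ∧ (∀ (n : ℕ) (y : Fin n → EuclideanSpace ℝ (Fin 3)) (w : Fin n → ℝ), 0 ≤ ∑ i, ∑ j, w i * w j * f (dist (y i) (y j))) ∧ (∀ r : ℝ, ρ ≤ r → f r ≤ Literature.MathematicalPhysics.StatisticalMechanics.lennardJones r) ∧ (∀ r : ℝ, ρ ≤ r → (f r = Literature.MathematicalPhysics.StatisticalMechanics.lennardJones r ↔ ∃ p ∈ (Literature.MathematicalPhysics.StatisticalMechanics.hcpPeriodicConfiguration ha hh).points, ∃ q ∈ (Literature.MathematicalPhysics.StatisticalMechanics.hcpPeriodicConfiguration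 ha hh).points, r = dist p q)) ∧ (∀ p ∈ (Literature.MathematicalPhysics.StatisticalMechanics.hcpPeriodicConfiguration ha hh).points, ∀ q ∈ (Literature.MathematicalPhysics.StatisticalMechanics.hcpPeriodicConfiguration ha hh).points, p ≠ q → ρ < dist p q → (∃ C δ : ℝ, 0 < δ ∧ ∀ s : ℝ, |s - dist p q| < δ → 0 ≤ Literature.MathematicalPhysics.StatisticalMechanics.lennardJones s - f s ∧ Literature.MathematicalPhysics.StatisticalMechanics.lennardJones s - f s ≤ C * (s - dist p q) ^ 2) ∧ HasDerivAt f (deriv Literature.MathematicalPhysics.StatisticalMechanics.lennardJones (dist p q)) (dist p q)) ∧ f 0 + 2 * (Literature.MathematicalPhysics.StatisticalMechanics.hcpPeriodicConfiguration ha hh).energyPerParticle f = 0 ∧ (∀ w : EuclideanSpace ℝ (Fin 3), HasSum (fun y : (Literature.MathematicalPhysics.StatisticalMechanics.hcpPeriodicConfiguration ha hh).points => f (dist w (y : EuclideanSpace ℝ (Fin 3)))) 0) ∧ (0 < f 0 ∧ f 0 ≤ -2 * (Literature.MathematicalPhysics.StatisticalMechanics.hcpPeriodicConfiguration ha hh).energyPerParticle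 Literature.MathematicalPhysics.StatisticalMechanics.lennardJones) ∧ ∫ ξ : EuclideanSpace ℝ (Fin 3), FourierTransform.fourier (fun v : EuclideanSpace ℝ (Fin 3) => (f ‖v‖ : ℂ)) ξ = (f 0 : ℂ)) ∧ (0 < δ ∧ ∀ r : ℝ, 0 ≤ r → r ≤ δ → 0 ≤ f 0 - f r ∧ f 0 - f r ≤ K * r ^ 2) ∧ (MeasureTheory.Integrable (fun ξ : EuclideanSpace ℝ (Fin 3) => ‖ξ‖ ^ 2 * (FourierTransform.fourier (fun v : EuclideanSpace ℝ (Fin 3) => (f ‖v‖ : ℂ)) ξ).re) ∧ ∫ ξ : EuclideanSpace ℝ (Fin 3), ‖ξ‖ ^ 2 * (FourierTransform.fourier (fun v : EuclideanSpace ℝ (Fin 3) => (f ‖v‖ : ℂ)) ξ).re ≤ 3 * K / (2 * Real.pi ^ 2)) ∧ ContDiff ℝ 2 (fun v : EuclideanSpace ℝ (Fin 3) => (f ‖v‖ : ℂ)) ∧ (∀ p₀ ∈ (Literature.MathematicalPhysics.StatisticalMechanics.hcpPeriodicConfiguration ha hh).points, ∀ w ∉ (Literature.MathematicalPhysics.StatisticalMechanics.hcpPeriodicConfiguration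 ha hh).points, f 0 - f (dist w p₀) ≤ ∑' q : {q : EuclideanSpace ℝ (Fin 3) // q ∈ (Literature.MathematicalPhysics.StatisticalMechanics.hcpPeriodicConfiguration ha hh).points ∧ q ≠ p₀}, (Literature.MathematicalPhysics.StatisticalMechanics.lennardJones (dist w q.1) - Literature.MathematicalPhysics.StatisticalMechanics.lennardJones (dist p₀ q.1))))

/-- **Negative lemma: `HcpFlatFarFieldEmpty → ¬ StrictCertificate`.**  Every witness `⟨hcp(a,h), ρ, c, g, U, f⟩`
of the crux yields `(a, h, max ρ 1, f, K, δ)` satisfying all twenty-two clauses. [folklore] -/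
theorem strictCertificate_false_of_hcpFlatFarFieldEmpty : HcpFlatFarFieldEmpty → ¬ StrictCertificate := by
  intro hH hS
  obtain ⟨P, ρ, c, g, U, f, ⟨a, h, ha, hh, rfl⟩, h1, h2, h3, h4, h5, h6, -, h9, hFc, hFi, hFF, hre,
    hstrictF⟩ := hS
  have hs : IsSplit ρ c g U f := ⟨h1, h2, h3, h4, h5⟩
  have hv : c + f 0 / 2 ≤ -((hcpPeriodicConfiguration ha hh).energyPerParticle lennardJones) := h6.le
  have hρ' : (0 : ℝ) < max ρ 1 := lt_max_of_lt_right one_pos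
  obtain ⟨K, δ, hδ, hflat, hI, hint, hC2⟩ :=
    integrable_norm_sq_mul_fourier_of_isSplit hs hv hFc hFi hFF hre
  refine hH a h ha hh (max ρ 1) f K δ ⟨⟨?_, ?_, hρ', hFc, hFi, hFF, hre, hstrictF,
    fourier_zero_eq_zero hs hv hFi, fun k hk => structureFactor_mul_fourier_eq_zero hs hv hFi hk, h4, ?_, ?_,
    ?_, f_zero_add_two_mul_energyPerParticle_f hs hv, fun w => invisible_of_isSplit hs hv w,
    ⟨hs.f_zero_pos, by linarith [hs.c_nonneg]⟩, integral_fourier_eq_f_zero f hFc hFi hFF⟩,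
    ⟨hδ, hflat⟩, ⟨hI, hint⟩, hC2, fun p₀ hp₀ w hw => f_zero_sub_f_le_lennardJones_cavity hs hv hp₀ hw⟩
  · -- (1) template minimality, by complementary slackness
    intro Q
    rw [(witness_eq hs hv).1]
    exact eStar_le Q
  · -- (2) virial / zero pressure of the witness template
    obtain ⟨hvir, hLJ, -⟩ :=
      stub_zeroPressure (hcpPeriodicConfiguration ha hh) fun t ht => le_energyPerParticle_dilate hs hv ht
    exact ⟨hvir, hLJ⟩
  · -- (12) one-sided contact beyond the range
    intro r hr
    have hr0 : 0 < r := lt_of_lt_of_le hρ' hr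
    have hV := h1 r hr0
    rw [h3 r ((le_max_left _ _).trans hr)] at hV
    linarith [h2 r hr0]
  · -- (13) exact contact set
    intro r hr
    exact f_eq_lennardJones_iff hs hv h9 ((le_max_left _ _).trans hr) (lt_of_lt_of_le hρ' hr)
  · -- (14) quadratic squeeze and tangency at template distances beyond the range
    intro p hp q hq hpq hρq
    exact stub_tangency _ ρ c g U f hs hv p hp q hq hpq (lt_of_le_of_lt (le_max_left _ _) hρq)

/-- **The new hypothesis is weaker**: `HcpFarFieldEmpty → HcpFlatFarFieldEmpty`. [folklore] -/
theorem hcpFlatFarFieldEmpty_of_hcpFarFieldEmpty : HcpFarFieldEmpty → HcpFlatFarFieldEmpty :=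
  fun hH a h ha hh ρ f _K _δ hall => hH a h ha hh ρ f hall.1

/-- Converse bookkeeping: a witness of the crux refutes `HcpFlatFarFieldEmpty`. [folklore] -/
theorem not_hcpFlatFarFieldEmpty_of_strictCertificate : StrictCertificate → ¬ HcpFlatFarFieldEmpty :=
  fun hS hH => strictCertificate_false_of_hcpFlatFarFieldEmpty hH hS

end Summit.AtomisticToContinuum.Crystallization.Theorems.StrictCertificate.Negative

end
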